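/-
Copyright (c) 2026. All rights reserved.
Released under Apache 2.0 license as described in the file LICENSE.
-/
import Literature.Probability.FitznerVanDerHofstad2017.NobleBoundsN1Cls22
import HarnessLib

/-!
# Fitzner–van der Hofstad (2017), §6.1 — the class `a = 0, b = 2` of (6.4) at `N = 1`

[FvdH17] = R. Fitzner, R. van der Hofstad, *Mean-field behavior for nearest-neighbor percolation in `d > 10`*,
Electron. J. Probab. **22** (2017), no. 43, arXiv:1506.07977v2.

The class `(a,b) = (0,2)` of §6.1 (v2 pp. 58–59): the first sausage is trivial (`w = u`, "Case `a = 0`") and the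
last sausage is non-trivial with `t` and `z` joined by a path of length at least two (`b = 2`):
`J(v−u) ℙ_p^{⊗2}(jointWit(u,v,w,z,t;x) ∩ class (0,2)) ≤ Σ_ι 𝟙{v = u + e_ι} P^{S,0}(u,w) Ā'^{ι,0,2}(u,w,t,z) P^{E,2}(t−x,z−x)`
with `P^{S,0}(u,w) = δ_{u,w} pdbc(u)`, `Ā^{ι,0,2}(u,w,t,z) = δ_{w,u} T*_{1,1̲,0}(u−z, u+e_ι−z, t−z)
= δ_{w,u} τ_1(u−z) τ_{1̲}(e_ι) τ(t−u−e_ι)`, `P^{E,2}` as in the class `(2,2)` — hypothesis `h2 0 2` of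
`NobleBoundsN1Classes.nobleXiT_one_le_blocks_of_cls` for `E = jointWit`.

Proof (same three moves as `NobleBoundsN1Cls22`): the level-`0` lines are `{0↔u}` twice (left triangle "Case
a = 0" of `NobleBoundsN1ClassTools`: `≤ P^{S,0}(u,u)`) and `{u ←1→ z}` (`z ≠ u`); `τ_{1̲}(e_ι) = p` absorbs `J(v−u)`;
the `Ā` factor is the independent product `τ(t−v) τ_1(u−z)`; the `P^E` factor is `T_{1,2,1}(t−x,z−x,0)`.
-/

namespace Literature.Probability.FitznerVanDerHofstad2017

open Literature.Barriers.CriticalPhenomena Literature.Probability.Percolation Literature.Probability.LatticeModels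
open Literature.Probability.FitznerVanDerHofstad2017.NobleBlocks
open Literature.Probability.FitznerVanDerHofstad2017.NobleBlocks.LenIdx MeasureTheory
open scoped ENNReal BigOperators

variable {d : ℕ}

/-! ### A. The row `(0,2)` of `Ā'` -/

/-- Row `(a,b) = (0,2)` of `Ā'^{ι,a,b} = Ā^{ι,a,b}`: `δ_{w,u} T*_{1,1̲,0}(−(z−u), e_ι−(z−u), (t−u)−(z−u))`, with
`T*` unfolded into its three two-point functions.
[cite: FitznerVanDerHofstad2017, App. B display `Ā^{ι,a,b}`, row `Ā^{ι,0,2}` (arXiv:1506.07977v2 p. 78); §4.2 (4.7)–(4.8) (p. 34)] -/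
theorem blockAbar'_zero_two (L : Letters d) (ι : Fin d × Bool) (u w t z : Site d) :
    blockAbar' L ι 0 2 u w t z = kd (w - u) 0 *
      (L.tau (.ge 1) (-(z - u)) * L.tau (.eq 1) (stepVec ι - (z - u) - -(z - u)) *
        L.tau (.ge 0) (t - u - (z - u) - (stepVec ι - (z - u)))) := by
  rw [blockAbar'_of_ne L ι (by decide)]; rfl

/-- The row `(0,2)` in the relevant configuration `w = u`, `v = u + e_ι`: `τ_1(u−z) τ_{1̲}(e_ι) τ(t−v)`.
[cite: FitznerVanDerHofstad2017, App. B row `Ā^{ι,0,2}` (arXiv:1506.07977v2 p. 78)] -/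
theorem blockAbar'_zero_two_eq (L : Letters d) (ι : Fin d × Bool) {u v : Site d} (hv : v = u + stepVec ι) (t z : Site d) :
    blockAbar' L ι 0 2 u u t z = L.tau (.ge 1) (u - z) * L.tau (.eq 1) (stepVec ι) * L.tau (.ge 0) (t - v) := by
  have e1 : -(z - u) = u - z := neg_sub z u
  have e2 : stepVec ι - (z - u) - -(z - u) = stepVec ι := by abel
  have e3 : t - u - (z - u) - (stepVec ι - (z - u)) = t - (u + stepVec ι) := by abel
  rw [blockAbar'_zero_two, sub_self, kd_self, one_mul, e2, e3, e1, hv]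

/-! ### B. What the class says about a configuration of the joint event -/

/-- On `jointWit ∩ class (0,2)`: the side conditions, `u = w`, `t ≠ z`, the bond `(t,z)` is closed on level `1`,
`z, t ≠ x` and `z ≠ u`. [cite: FitznerVanDerHofstad2017, §6.1 "Case a = 0", "b = 2" (arXiv:1506.07977v2 pp. 58–59)] -/
theorem cls02_facts {u v w z t x : Site d} {ω : Fin 2 → BondConfig (Site d)} (hω : ω ∈ jointWit u v w z t x)
    (hc : ω ∈ clsSet u w t z 0 2) :
    JWSide u v w z t x ∧ u = w ∧ t ≠ z ∧ s(t, z) ∉ ω 1 ∧ z ≠ x ∧ t ≠ x ∧ z ≠ u := by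
  have hs : JWSide u v w z t x := hω.1
  have h0 : u = w := (mem_lineCls_zero_iff u w 0 ω).1 hc.1
  have h1 : t ≠ z ∧ s(t, z) ∉ ω 1 := (mem_lineCls_two_iff t z 1 ω).1 hc.2
  exact ⟨hs, h0, h1.1, h1.2, fun hzx => h1.1 ((hs.2.1.1 hzx).trans hzx.symm),
    fun htx => h1.1 (htx.trans (hs.2.1.2 htx).symm), hs.2.2.2.2.2.1⟩

/-- The class is empty unless `w = u` and the last sausage is non-trivial. [cite: FitznerVanDerHofstad2017, §6.1 (arXiv:1506.07977v2 pp. 58–59)] -/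
theorem jointWit_inter_cls02_eq_empty {u v w z t x : Site d} (h : w ≠ u ∨ z = x ∨ t = x) :
    jointWit u v w z t x ∩ clsSet u w t z 0 2 = ∅ :=
  Set.eq_empty_iff_forall_notMem.2 fun ω hω => by
    obtain ⟨-, huw, -, -, hzx, htx, -⟩ := cls02_facts hω.1 hω.2
    rcases h with h | h | h
    exacts [h huw.symm, hzx h, htx h]

/-! ### C. The upgraded lines -/

/-- Upgraded lines (`w = u`): `{0↔u}` twice, `{u↔u}`, `{z ←1→ u}` on level `0`; `{v↔t}, {t ←2→ z}, {x ←1→ t},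
{z ←1→ x}` on level `1`. [cite: FitznerVanDerHofstad2017, §6.1 "Case a = 0", "b = 2" (arXiv:1506.07977v2 pp. 58–59)] -/
def lines02 (u v z t x : Site d) : Fin 4 ⊕ Fin 4 → Set (BondConfig (Site d)) :=
  Sum.elim ![event (.ge 0) 0 u, event (.ge 0) 0 u, event (.ge 0) u u, event (.ge 1) z u]
    ![event (.ge 0) v t, event (.ge 2) t z, event (.ge 1) x t, event (.ge 1) z x]

/-- The upgraded lines are finitary (paths are finite). [folklore] -/
theorem isFinitary_lines02 (u v z t x : Site d) (i : Fin 4 ⊕ Fin 4) : IsFinitary (lines02 (d := d) u v z t x i) := by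
  rcases i with i | i <;> fin_cases i
  all_goals first | exact isFinitary_event (.ge 0) _ _ | exact isFinitary_event (.ge 1) _ _ |
    exact isFinitary_event (.ge 2) _ _

/-- The upgrades. [cite: FitznerVanDerHofstad2017, §6.1 "Case a = 0", "b = 2" (arXiv:1506.07977v2 pp. 58–59)] -/
theorem upgrade02 {u v z t x : Site d} :
    ∀ ω ∈ jointWit u v u z t x ∩ clsSet u u t z 0 2, ∀ i (K : Set (Sym2 (Site d))),
      K ⊆ ω (jwCfg i) → K ∈ jwLines u v u z t x i → K ∈ lines02 u v z t x i := by
  rintro ω hω (i | i) K hK hKi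
  · obtain ⟨-, -, -, -, -, -, hzu⟩ := cls02_facts hω.1 hω.2
    fin_cases i
    · show K ∈ event (.ge 0) 0 u
      exact mem_openConnGe_zero_of_mem hKi
    · show K ∈ event (.ge 0) 0 u
      exact mem_openConnGe_zero_of_mem hKi
    · show K ∈ event (.ge 0) u u
      exact mem_openConnGe_zero_of_mem hKi
    · show K ∈ event (.ge 1) z u
      rw [event_comm]
      exact mem_openConnGe_one_of_ne hKi hzu.symm
  · obtain ⟨-, -, htz, hb1, hzx, htx, -⟩ := cls02_facts hω.1 hω.2
    exact upgrade₁_two htz hb1 hzx htx i K hK hKi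

/-- **Middle piece, row `(0,2)`** (`w = u`): the factor `p = J(v−u) = τ_{1̲}(e_ι)` and the lines `{v ↔ t}₁`,
`{z ←1→ u}₀` on different levels give `τ_1(u−z) τ_{1̲}(e_ι) τ(t−v) = Ā^{ι,0,2}(u,u,t,z)`.
[cite: FitznerVanDerHofstad2017, §6.1 after (6.4) and App. B row `Ā^{ι,0,2}` (arXiv:1506.07977v2 pp. 58, 78)] -/
theorem ofReal_mul_piPerc_mid_zero_two_le_blockAbar' (p : unitInterval) {ι : Fin d × Bool} {u v : Site d}
    (hv : v = u + stepVec ι) (t z : Site d) (c : Fin 2 → Fin 2) (hc : c 0 ≠ c 1) :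
    ENNReal.ofReal p * piPerc d p 2 (genDisjOcc ![event (.ge 0) v t, event (.ge 1) z u] c) ≤
      blockAbar' (Letters.perc d p) ι 0 2 u u t z := by
  rw [blockAbar'_zero_two_eq _ ι hv, perc_tau_eq_one_stepVec]
  calc ENNReal.ofReal p * piPerc d p 2 (genDisjOcc ![event (.ge 0) v t, event (.ge 1) z u] c)
      ≤ ENNReal.ofReal p * ((Letters.perc d p).tau (.ge 0) (t - v) * (Letters.perc d p).tau (.ge 1) (u - z)) :=
        mul_le_mul' le_rfl (piPerc_two_genDisjOcc_two_le_tau_mul p (.ge 0) (.ge 1) v t z u c hc)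
    _ = (Letters.perc d p).tau (.ge 1) (u - z) * ENNReal.ofReal p * (Letters.perc d p).tau (.ge 0) (t - v) := by
        ring

/-! ### D. The class estimate -/

/-- **[FvdH17] §6.1, class `a = 0, b = 2` of (6.4) at `N = 1`.**
[cite: FitznerVanDerHofstad2017, §6.1 (6.4) with "Case a = 0", "b = 2" (arXiv:1506.07977v2 pp. 58–59); App. B rows `P^{S,0}`, `Ā^{ι,0,2}`, `P^{E,2}` (pp. 73, 78)] -/
theorem jointWit_cls_zero_two (p : unitInterval) (x u v w z t : Site d) :
    ENNReal.ofReal (bondJ d p (v - u)) * piPerc d p 2 (jointWit u v w z t x ∩ clsSet u w t z 0 2) ≤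
      ∑ ι : Fin d × Bool, (if v = u + stepVec ι then (1 : ℝ≥0∞) else 0) *
        (blockPS (Letters.perc d p) 0 u w * blockAbar' (Letters.perc d p) ι 0 2 u w t z *
          blockPE (Letters.perc d p) 2 (t - x) (z - x)) := by
  -- degenerate parameters: the class is empty
  by_cases hdeg : w ≠ u ∨ z = x ∨ t = x
  · exact ofReal_bondJ_mul_le_of_eq_empty p u v (jointWit_inter_cls02_eq_empty hdeg) _
  push Not at hdeg
  obtain ⟨hwu, hzx, htx⟩ := hdeg
  subst hwu
  refine ofReal_bondJ_mul_le_sum_ite p w v _ _ fun ι hv => ?_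
  have h3 := piPerc_jointWit_inter_le_prod₃ p w v w z t x (clsSet w w t z 0 2) (lines02 w v z t x)
    (isFinitary_lines02 w v z t x) grpN1 grpN1_adm upgrade02
  refine mul_le_blocks_of_factors h3 ?_ ?_ ?_
  · exact piPerc_grpN1_le p _ 0 ![Sum.inl 0, Sum.inl 1] (by decide) (by intro m; fin_cases m <;> rfl)
      (by funext m; fin_cases m <;> rfl) (piPerc_start_zero_le_blockPS p w _ (by rfl))
  · exact mul_piPerc_grpN1_le p _ _ 1 ![Sum.inr 0, Sum.inl 3] (by decide) (by intro m; fin_cases m <;> rfl)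
      (by funext m; fin_cases m <;> rfl) (ofReal_mul_piPerc_mid_zero_two_le_blockAbar' p hv t z _ (by decide))
  · exact piPerc_grpN1_le p _ 2 ![Sum.inr 2, Sum.inr 1, Sum.inr 3] (by decide) (by intro m; fin_cases m <;> rfl)
      (by funext m; fin_cases m <;> rfl) (piPerc_end_two_le_blockPE p hzx htx _)

end Literature.Probability.FitznerVanDerHofstad2017
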